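import Summits.BirchSwinnertonDyer.Rank1Residual.Additive.SemistableTwistTamagawaFree
import Summits.BirchSwinnertonDyer.Rank1Residual.Additive.TwistRamTransport
import Summits.BirchSwinnertonDyer.Rank1Residual.Additive.QuadraticTwistSurj
import Literature.NumberTheory.EllipticCurves.BSDSelmerPConverseSerreProofs
import HarnessLib

/-!
# X4 ∧ `r_an = 0` ∧ (semistable twist), `p ≡ 3 (mod 4)`: the image hypothesis reduced to census bits of `E` — `surj(p)` for `p ≥ 7`, `surj(p) ∧ ram(p)` for every `p` incl. `3` (cell `b2b-bsdres`, seat additive-p4, lines V9b/V9e)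

HONEST FRAMING (cell `b2b-bsdres`, run/shared/lean/b2b/bsd-rank1-residual/, verbatim in every
file): the goal of the cell is to DELETE the COMBINATION-SHAPED residual classes of the
Birch–Swinnerton-Dyer formula for ALL analytic-rank `≤ 1` elliptic curves over `ℚ` — "full BSD
formula for every rank `≤ 1` curve in class `C`" assembled STRICTLY from published theorems — so
that the rank-`≤ 1` remainder becomes exactly the CONSTRUCTION-SHAPED classes, which are TYPED
(missing-input `Prop`s), NOT attempted. This is not "finishing BSD". The additive sub-cell (seats
additive-p1…p4) is a RESEARCH ROUTE on the construction-shaped classes X3/X4; no claim beyond the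
stated classes; the label of X4 is UNCHANGED.

Theorems only (no definition, no named fact). The X4 odd assembly (`X4RankZeroTwistOdd.*`, p204500,
Tamagawa-free form in `SemistableTwistTamagawaFree.lean`) carries the `p`-ADIC image hypothesis
`hsurj : ∀ n, ρ̄_{V,pⁿ}` onto for the semistable twist `V = E♭` (the shape of Kato's big-image
divisibility). For `p ≥ 5` this is implied by mod-`p` surjectivity (Serre's lemma, tree theorem
`serre_hasSurjectiveModNGaloisRep_pow_holds`), and mod-`p` surjectivity is a twist invariant
(additive-p2's `surj_iff_of_model_twist`, p204512), so at `p ≡ 3 (mod 4)`, `p ≥ 7` the hypothesis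
is the census bit `surj(p)` OF `E` ITSELF (`Surj W p`):

* `X4RankZeroTwistOdd.forall_surj_pow_twist_of_surj` — `p ≥ 5`, `W ≅ V^{(d)}`, `Surj W p` ⇒
  `∀ n, Surj V (pⁿ)`;
* `X4RankZeroTwistOdd.padicValNat_shaOrder_le_shaAn_of_surj`,
  `.missingUpperBoundAt_of_surj`, `.bsdp_of_surj_of_shaAn_unit` — X4 ∧ `r_an = 0` ∧
  (`E ≅ V^{(−p)}`, `V` good ordinary or multiplicative at `p`) ∧ `p ≡ 3 (mod 4)` ∧ `p ≥ 7` ∧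
  `surj(p)`: `ord_p #Ш(E) ≤ ord_p #Ш_an(E)`, `Typed.MissingUpperBoundAt`, and `BSD(E,p)` on the
  `p ∤ #Ш_an` rows — granted the ONE typed input `ChiBranchLeadingTermOddBigImageAt W p`; inputs
  otherwise Delbourgo 1998 Prop. 4 (`hDel`), GZK (`hGZK`), modularity (`hmod`).
At `p = 3` Serre's lemma fails; there (and at every `p ≡ 3 (mod 4)`) the `p`-adic surjectivity of
`E♭` follows from `surj(p)` AND (ram) for `E` — a multiplicative prime `ℓ ≠ p` with
`p ∤ v_ℓ(Δ_min(E))` — transported to the twist (`Additive/TwistRamTransport.lean`,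
`forall_surj_pow_of_twist_pStar_of_surj_of_ram`: the twist by `p* = −p ≡ 1 (mod 4)` is unramified
at every `ℓ ≠ p`; tree theorem `hasSurjectiveModNGaloisRep_pow_of_hasMultiplicativeReductionAtPrime`):

* `X4RankZeroTwistOdd.padicValNat_shaOrder_le_shaAn_of_surj_of_ram`,
  `.missingUpperBoundAt_of_surj_of_ram`, `.bsdp_of_surj_of_ram_of_shaAn_unit` — X4 ∧ `r_an = 0` ∧
  (semistable twist) ∧ `p ≡ 3 (mod 4)` (**`p = 3` included**) ∧ `surj(p)` ∧ `ram(p)`: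
  `ord_p #Ш(E) ≤ ord_p #Ш_an(E)`, `Typed.MissingUpperBoundAt`, `BSD(E,p)` on the `p ∤ #Ш_an` rows,
  granted the ONE typed input; every other hypothesis is a census bit of `E` (hyp_bits: `surj`,
  `ram`, `pot_mult`/`tame`+twist-ordinarity, `ordp_sha`).

References: [SerreAbelianLadic1968] IV §3.4 Lemma 3; [Kato2004Asterisque] Thm. 17.4; [Delbourgo1998]
Prop. 4; [Miller2011LMS] Def. 1.1.
-/

noncomputable section

open scoped Classical MatrixGroups ModularForm

open CongruenceSubgroup WeierstrassCurve Literature.NumberTheory.EllipticCurves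
  Literature.NumberTheory.EllipticCurves.ModularForms
  Literature.NumberTheory.EllipticCurves.Rank1Residual

namespace Summit.BirchSwinnertonDyer.Rank1Residual.Additive

open IsDedekindDomain NumberField Rat.HeightOneSpectrum
  Literature.NumberTheory.EllipticCurves.Rank1Residual.Typed

variable (W : WeierstrassCurve ℚ) [W.IsElliptic] [W.IsGloballyMinimal] (p : ℕ) [hp : Fact p.Prime]

omit [W.IsElliptic] [W.IsGloballyMinimal] in
/-- **`p`-adic surjectivity of the twist from mod-`p` surjectivity of `E`, `p ≥ 5`.** If
`W ≅ V^{(d)}` (`d ≠ 0`) and `ρ̄_{W,p}` is onto, then `ρ̄_{V,pⁿ}` is onto for every `n`: `Surj` is a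
twist invariant (`surj_iff_of_model_twist`) and Serre's lemma lifts (`serre_hasSurjectiveModNGaloisRep_pow_holds`).
[cite: SerreAbelianLadic1968, Ch. IV §3.4, Lemma 3] -/
theorem X4RankZeroTwistOdd.forall_surj_pow_twist_of_surj (hp5 : 5 ≤ p)
    (V : WeierstrassCurve ℚ) [V.IsElliptic] {d : ℚ} (hd : d ≠ 0)
    (C : VariableChange ℚ) (hC : C • V.quadraticTwist d = W) (hsurj : Surj W p) (n : ℕ) :
    V.HasSurjectiveModNGaloisRep (p ^ n : ℕ) :=
  serre_hasSurjectiveModNGaloisRep_pow_holds V p hp5 ((surj_iff_of_model_twist V p hd ⟨C, hC⟩).mp hsurj) n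

omit [W.IsElliptic] [W.IsGloballyMinimal] in
/-- `p ≡ 3 (mod 4)` and `p ≠ 3` give `p ≥ 5` (indeed `p ≥ 7`). -/
private theorem five_le_of_mod_four_eq_three_of_ne_three (hp4 : p % 4 = 3) (hp3 : p ≠ 3) : 5 ≤ p := by
  have h2 := hp.out.two_le
  by_contra h
  interval_cases p <;> simp_all

/-- **`ord_p #Ш(E) ≤ ord_p #Ш_an(E)` on X4 ∧ `r_an = 0` ∧ (semistable twist), `p ≡ 3 (mod 4)`,
`p ≠ 3`, under `surj(p)` for `E`**, granted the Kato-shaped typed input. -/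
theorem X4RankZeroTwistOdd.padicValNat_shaOrder_le_shaAn_of_surj
    (hDel : Delbourgo1998.prop4_rankZero_pow_dvd_constantCoeff)
    (hGZK : rank_eq_analyticRank_of_analyticRank_le_one) (hmod : hasEntireLFunction_rat)
    (hBC : ChiBranchLeadingTermOddBigImageAt W p)
    (hp4 : p % 4 = 3) (hp3 : p ≠ 3) (hr : W.analyticRank = 0) (hX : ClassX4 W p) (hsurj : Surj W p)
    (V : WeierstrassCurve ℚ) [V.IsElliptic] [V.IsGloballyMinimal]
    (C : VariableChange ℚ) (hC : C • V.quadraticTwist (-(p : ℚ)) = W) (hV : GoodOrd V p ∨ Mult V p)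
    {N : ℕ} [NeZero N] {f : CuspForm (Gamma0 N) 2} (hf : IsNewformOf V f)
    (ϖ : ℚ) (hϖ : (ϖ : ℝ) * V.imaginaryPeriodRat = minusPeriod f) :
    ∃ q : ℚ, shaAn W = (q : ℂ) ∧ (padicValNat p W.shaOrder : ℤ) ≤ padicValRat p q :=
  X4RankZeroTwistOdd.padicValNat_shaOrder_le_shaAn W p hDel hGZK hmod hBC hp4 hr hX V C hC hV
    (X4RankZeroTwistOdd.forall_surj_pow_twist_of_surj W p
      (five_le_of_mod_four_eq_three_of_ne_three p hp4 hp3) V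
      (neg_ne_zero.mpr (Nat.cast_ne_zero.mpr hp.out.ne_zero)) C hC hsurj)
    hf ϖ hϖ

/-- **`Typed.MissingUpperBoundAt W p` on X4 ∧ `r_an = 0` ∧ (semistable twist), `p ≡ 3 (mod 4)`,
`p ≠ 3`, under `surj(p)` for `E`**, granted the Kato-shaped typed input. -/
theorem X4RankZeroTwistOdd.missingUpperBoundAt_of_surj
    (hDel : Delbourgo1998.prop4_rankZero_pow_dvd_constantCoeff)
    (hGZK : rank_eq_analyticRank_of_analyticRank_le_one) (hmod : hasEntireLFunction_rat)
    (hBC : ChiBranchLeadingTermOddBigImageAt W p)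
    (hp4 : p % 4 = 3) (hp3 : p ≠ 3) (hr : W.analyticRank = 0) (hX : ClassX4 W p) (hsurj : Surj W p)
    (V : WeierstrassCurve ℚ) [V.IsElliptic] [V.IsGloballyMinimal]
    (C : VariableChange ℚ) (hC : C • V.quadraticTwist (-(p : ℚ)) = W) (hV : GoodOrd V p ∨ Mult V p)
    {N : ℕ} [NeZero N] {f : CuspForm (Gamma0 N) 2} (hf : IsNewformOf V f)
    (ϖ : ℚ) (hϖ : (ϖ : ℝ) * V.imaginaryPeriodRat = minusPeriod f) :
    MissingUpperBoundAt W p := by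
  obtain ⟨q, hq, hle⟩ := X4RankZeroTwistOdd.padicValNat_shaOrder_le_shaAn_of_surj W p hDel hGZK hmod
    hBC hp4 hp3 hr hX hsurj V C hC hV hf ϖ hϖ
  exact ⟨q, hq, hle⟩

/-- **`BSD(E,p)` on the `p ∤ #Ш_an(E)` rows of X4 ∧ `r_an = 0` ∧ (semistable twist),
`p ≡ 3 (mod 4)`, `p ≠ 3`, under `surj(p)` for `E`**, granted the Kato-shaped typed input. -/
theorem X4RankZeroTwistOdd.bsdp_of_surj_of_shaAn_unit
    (hDel : Delbourgo1998.prop4_rankZero_pow_dvd_constantCoeff)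
    (hGZK : rank_eq_analyticRank_of_analyticRank_le_one) (hmod : hasEntireLFunction_rat)
    (hBC : ChiBranchLeadingTermOddBigImageAt W p)
    (hp4 : p % 4 = 3) (hp3 : p ≠ 3) (hr : W.analyticRank = 0) (hX : ClassX4 W p) (hsurj : Surj W p)
    (V : WeierstrassCurve ℚ) [V.IsElliptic] [V.IsGloballyMinimal]
    (C : VariableChange ℚ) (hC : C • V.quadraticTwist (-(p : ℚ)) = W) (hV : GoodOrd V p ∨ Mult V p)
    {N : ℕ} [NeZero N] {f : CuspForm (Gamma0 N) 2} (hf : IsNewformOf V f)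
    (ϖ : ℚ) (hϖ : (ϖ : ℝ) * V.imaginaryPeriodRat = minusPeriod f)
    {q : ℚ} (hq : shaAn W = (q : ℂ)) (hv : padicValRat p q = 0) : BSDp W p :=
  bsdp_of_missingPPartAt W p hGZK (by rw [hr]; exact zero_le_one)
    (missingPPartAt_of_upper_of_shaAn_unit W p
      (X4RankZeroTwistOdd.missingUpperBoundAt_of_surj W p hDel hGZK hmod hBC hp4 hp3 hr hX hsurj V C
        hC hV hf ϖ hϖ) hq hv)

/-! ## Every `p ≡ 3 (mod 4)`, `p = 3` included: `surj(p) ∧ ram(p)` -/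

omit [W.IsElliptic] [W.IsGloballyMinimal] hp in
/-- `p ≡ 3 (mod 4)` gives `−p = 4k + 1` with `k = −(p+1)/4`. -/
private theorem neg_eq_four_mul_add_one (hp4 : p % 4 = 3) :
    (-(p : ℤ)) = 4 * (-((p / 4 : ℕ) : ℤ) - 1) + 1 := by
  have h := Nat.div_add_mod p 4
  push_cast
  omega

/-- **`ord_p #Ш(E) ≤ ord_p #Ш_an(E)` on X4 ∧ `r_an = 0` ∧ (semistable twist) at every
`p ≡ 3 (mod 4)`, `p = 3` INCLUDED, under `surj(p) ∧ ram(p)` for `E`**, granted the Kato-shaped typed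
input: the `p`-adic surjectivity of `E♭` is `forall_surj_pow_of_twist_pStar_of_surj_of_ram`. -/
theorem X4RankZeroTwistOdd.padicValNat_shaOrder_le_shaAn_of_surj_of_ram
    (hDel : Delbourgo1998.prop4_rankZero_pow_dvd_constantCoeff)
    (hGZK : rank_eq_analyticRank_of_analyticRank_le_one) (hmod : hasEntireLFunction_rat)
    (hBC : ChiBranchLeadingTermOddBigImageAt W p)
    (hp4 : p % 4 = 3) (hr : W.analyticRank = 0) (hX : ClassX4 W p) (hsurj : Surj W p) (hram : Ram W p)
    (V : WeierstrassCurve ℚ) [V.IsElliptic] [V.IsGloballyMinimal]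
    (C : VariableChange ℚ) (hC : C • V.quadraticTwist (-(p : ℚ)) = W) (hV : GoodOrd V p ∨ Mult V p)
    {N : ℕ} [NeZero N] {f : CuspForm (Gamma0 N) 2} (hf : IsNewformOf V f)
    (ϖ : ℚ) (hϖ : (ϖ : ℝ) * V.imaginaryPeriodRat = minusPeriod f) :
    ∃ q : ℚ, shaAn W = (q : ℂ) ∧ (padicValNat p W.shaOrder : ℤ) ≤ padicValRat p q := by
  have hC' : C • V.quadraticTwist (((-(p : ℤ)) : ℤ) : ℚ) = W := by push_cast; exact hC
  exact X4RankZeroTwistOdd.padicValNat_shaOrder_le_shaAn W p hDel hGZK hmod hBC hp4 hr hX V C hC hV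
    (forall_surj_pow_of_twist_pStar_of_surj_of_ram p V (neg_eq_four_mul_add_one p hp4) (Or.inr rfl)
      C hC' hsurj hram) hf ϖ hϖ

/-- **`Typed.MissingUpperBoundAt W p` on X4 ∧ `r_an = 0` ∧ (semistable twist), every
`p ≡ 3 (mod 4)` incl. `3`, under `surj(p) ∧ ram(p)`**, granted the Kato-shaped typed input — the
"≤" half of X4♯(3) on the semistable-twist rows with EVERY hypothesis a census bit of `E`. -/
theorem X4RankZeroTwistOdd.missingUpperBoundAt_of_surj_of_ram
    (hDel : Delbourgo1998.prop4_rankZero_pow_dvd_constantCoeff)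
    (hGZK : rank_eq_analyticRank_of_analyticRank_le_one) (hmod : hasEntireLFunction_rat)
    (hBC : ChiBranchLeadingTermOddBigImageAt W p)
    (hp4 : p % 4 = 3) (hr : W.analyticRank = 0) (hX : ClassX4 W p) (hsurj : Surj W p) (hram : Ram W p)
    (V : WeierstrassCurve ℚ) [V.IsElliptic] [V.IsGloballyMinimal]
    (C : VariableChange ℚ) (hC : C • V.quadraticTwist (-(p : ℚ)) = W) (hV : GoodOrd V p ∨ Mult V p)
    {N : ℕ} [NeZero N] {f : CuspForm (Gamma0 N) 2} (hf : IsNewformOf V f)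
    (ϖ : ℚ) (hϖ : (ϖ : ℝ) * V.imaginaryPeriodRat = minusPeriod f) :
    MissingUpperBoundAt W p := by
  obtain ⟨q, hq, hle⟩ := X4RankZeroTwistOdd.padicValNat_shaOrder_le_shaAn_of_surj_of_ram W p hDel
    hGZK hmod hBC hp4 hr hX hsurj hram V C hC hV hf ϖ hϖ
  exact ⟨q, hq, hle⟩

/-- **`BSD(E,p)` — `BSD(E,3)` included — on the `p ∤ #Ш_an(E)` rows of X4 ∧ `r_an = 0` ∧
(semistable twist), `p ≡ 3 (mod 4)`, under `surj(p) ∧ ram(p)`**, granted the Kato-shaped typed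
input. No Kurihara number, no Manin constant, no Tamagawa bit, no image datum on `E♭`. -/
theorem X4RankZeroTwistOdd.bsdp_of_surj_of_ram_of_shaAn_unit
    (hDel : Delbourgo1998.prop4_rankZero_pow_dvd_constantCoeff)
    (hGZK : rank_eq_analyticRank_of_analyticRank_le_one) (hmod : hasEntireLFunction_rat)
    (hBC : ChiBranchLeadingTermOddBigImageAt W p)
    (hp4 : p % 4 = 3) (hr : W.analyticRank = 0) (hX : ClassX4 W p) (hsurj : Surj W p) (hram : Ram W p)
    (V : WeierstrassCurve ℚ) [V.IsElliptic] [V.IsGloballyMinimal]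
    (C : VariableChange ℚ) (hC : C • V.quadraticTwist (-(p : ℚ)) = W) (hV : GoodOrd V p ∨ Mult V p)
    {N : ℕ} [NeZero N] {f : CuspForm (Gamma0 N) 2} (hf : IsNewformOf V f)
    (ϖ : ℚ) (hϖ : (ϖ : ℝ) * V.imaginaryPeriodRat = minusPeriod f)
    {q : ℚ} (hq : shaAn W = (q : ℂ)) (hv : padicValRat p q = 0) : BSDp W p :=
  bsdp_of_missingPPartAt W p hGZK (by rw [hr]; exact zero_le_one)
    (missingPPartAt_of_upper_of_shaAn_unit W p
      (X4RankZeroTwistOdd.missingUpperBoundAt_of_surj_of_ram W p hDel hGZK hmod hBC hp4 hr hX hsurj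
        hram V C hC hV hf ϖ hϖ) hq hv)

end Summit.BirchSwinnertonDyer.Rank1Residual.Additive

end
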